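import Summits.BirchSwinnertonDyer.BirchSwinnertonDyer.Theses.SignedLowerHalves
import Summits.BirchSwinnertonDyer.BirchSwinnertonDyer.Theorems.SignedLowerHalvesKobayashiMainConjectureSmallImageKatoIntegralOfMu
import HarnessLib

/-!
# Route `SignedLowerHalves` (K3), rev 18: the GLUE of the `μ`-resplit (gen 2) of crux 4 `KobayashiMainConjectureSmallImage`
# (stmt-BirchSwinnertonDyer-19002) — item stmt-BirchSwinnertonDyer-23602 `KobayashiMainConjectureSmallImageOfMuParts`, PROVED
# (cell `bsd-ssimc`, LEAD seat `bsd-line-slh-p3` gen 14)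

The tenure planner's turnkey #6 (director-bsd GO 6a; K3 rev 17 → 18, commit 6c16132035212a10, 2026-08-28T21:58Z) re-split crux 4
into three children and a glue, VERBATIM from `Theses/SignedLowerHalves.lean` rev 18:

* L `SmallImageLowerHalfBothSigns` (stmt-23599, crux 401) — the Eisenstein (lower) half of Kobayashi's signed main conjecture for
  BOTH signs at every small-image supersingular X7 pair (odd `p`, `ClassX7 W p`, non-CM, `a_p = 0`, `¬ Surj W p`);
* M `SmallImageMuZeroOneSign` (stmt-23600, crux 402) — Kobayashi's `μ`-conjecture for ONE sign at every such pair: some `ε` with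
  `μ(ξ) = 0` for every characteristic power series `ξ` of every key-`γ` signed Selmer dual datum of sign `ε`;
* P `SmallImagePrintedInputsMu` (stmt-23601, support 403) — the printed inputs BY NAME: Kobayashi 2003 Thm. 1.2 ∧ Thm. 4.1 ∧ the
  period-unit statements at `p ≥ 5` and `p = 3`;
* glue `KobayashiMainConjectureSmallImageOfMuParts := L → M → P → KobayashiMainConjectureSmallImage` (stmt-23602, support 404).

This file PROVES the glue: it is LEAD gen 12's calibration `SmallImageParityStratumExact.kobayashiMainConjectureSmallImage_of_lower_of_mu`
(p668179: crux 4 BY NAME ⟸ `h12 h41 h5 h3` ∧ «at every pair of the domain SOME sign has the Eisenstein half AND `μ^ε = 0`» — `p` is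
prime in `Λ`, so Kato's rational inclusion becomes integral once `μ^ε = 0`, p667339) re-threaded over the three children as hypotheses
(= the planner's certificate `SketchMuResplitV1.lean` 0f45ade1a0127814). To keep this glue OFF the theses cone of other Theorems
modules (gate lint `theses-cone`), p668179's three-line argument is repeated here over its ROUTE-INDEPENDENT kernel
`SmallImageKatoIntegralOfMu.kobayashiMainConjecture_of_lowerDivisibility_of_mu_eq_zero` (p667339) instead of importing the module
`…ParityStratumExactCrux` (which imports the route file):

* `lower_and_mu_of_children` — from L and M, at every pair of the domain the sign `ε` given by M carries both the Eisenstein half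
  (L gives it for every sign) and `μ^ε = 0` (= p668179's hypothesis `hlowμ`);
* `kobayashiMainConjectureSmallImage_of_children` — crux 4 BY NAME from L, M, P (p668179's three lines over p667339's kernel);
* `kobayashiMainConjectureSmallImageOfMuParts_holds : KobayashiMainConjectureSmallImageOfMuParts` — the route decl, closing stmt-23602;
* `smallImagePrintedInputsMu_of_items` — certificate: the route's in-cone support items 19286 / 19287 / 19288 / 19291
  (`KobayashiSignedSelmerTorsion`, `KobayashiSignedKatoDivisibility`, `RealPeriodUnitPlusPeriod`, `RealPeriodUnitPlusPeriodThree`)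
  supply P verbatim.

HONEST SCOPE: this is the COMPOSITION only. The children L (signed lower half, both signs, at non-surjective image and
non-square-free level — beyond print) and M (Perrin-Riou's / Kobayashi's one-sign `μ`-conjecture on the residually `K`-dihedral
class — open) are hypotheses of the glue and stay OPEN items; P is held print. Crux 4 is NOT proved; no summit statement / BSD case is
proved by this file.

References: [Kobayashi2003] Conjecture p. 2, Thm. 1.2, Thm. 4.1; [PollackWeston2011] Thm. 4.1 / Rem. 4.2 (arXiv:0906.1741 p. 10);
[GreenbergVatsal2000] p. 4; [Mazur1978] Cor. 4.1; [Washington1997] §13.1; tree: `Theses/SignedLowerHalves.lean` rev 18 ll. 309–357,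
`Theorems/SignedLowerHalvesKobayashiMainConjectureSmallImageParityStratumExactCrux.lean` §2 (p668179),
`Theorems/SignedLowerHalvesKobayashiMainConjectureSmallImageKatoIntegralOfMu.lean` (p667339).
-/

-- D-0017: single-problem summit, the namespace repeats the problem name by design.
set_option linter.dupNamespace false
set_option autoImplicit false

noncomputable section

namespace Summit.BirchSwinnertonDyer.BirchSwinnertonDyer.Theorems.SmallImageMuParts

open WeierstrassCurve Field Literature.NumberTheory.EllipticCurves Literature.NumberTheory.EllipticCurves.Rank1Residual
  Literature.NumberTheory.EllipticCurves.Kobayashi2003 ZpExtension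
  Summit.BirchSwinnertonDyer.Rank1Residual.X1.MuLambda
  Summit.BirchSwinnertonDyer.Rank1Residual.Supersingular
  Summit.BirchSwinnertonDyer.BirchSwinnertonDyer.Theses.SignedLowerHalves

/-- **From children L and M: at every pair of the domain, ONE sign with the Eisenstein half AND `μ^ε = 0`.** The sign is the one
M produces; L supplies the lower divisibility for it (L gives it for every sign). This is exactly the hypothesis `hlowμ` of
`SmallImageParityStratumExact.kobayashiMainConjectureSmallImage_of_lower_of_mu`.
[cite: Kobayashi2003, Conjecture (Main Conjecture) (p. 2)] -/
theorem lower_and_mu_of_children (hL : SmallImageLowerHalfBothSigns) (hM : SmallImageMuZeroOneSign)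
    (W : WeierstrassCurve ℚ) [W.IsElliptic] [W.IsGloballyMinimal] (p : ℕ) [Fact p.Prime]
    (hp : p ≠ 2) (hX : ClassX7 W p) (hCM : ¬ W.HasCM) (hap : W.frobeniusTrace p = 0) (hs : ¬ Surj W p) :
    ∃ ε : ℤˣ, KobayashiLowerDivisibility W p ε ∧
      ∀ (κ : ZpExtension ℚ p) (γ : absoluteGaloisGroup ℚ), κ.IsCyclotomic → κ.IsTopGenerator γ →
        IsCyclotomicVariable p γ → ∀ (D : SignedSelmerDualData W κ γ ε) (ξ : IwasawaAlgebra p),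
          D.charIdeal = Ideal.span {ξ} → mu ξ = 0 := by
  obtain ⟨ε, hμ⟩ := hM W p hp hX hCM hap hs
  exact ⟨ε, hL W p hp hX hCM hap hs ε, hμ⟩

/-- **Crux 4 BY NAME from the three children of the `μ`-resplit** — L (lower half, both signs), M (`μ = 0`, one sign), P (the
printed inputs `h12 ∧ h41 ∧ h5 ∧ h3`). This is p668179's `SmallImageParityStratumExact.kobayashiMainConjectureSmallImage_of_lower_of_mu`
with the same three-line proof, fed by `lower_and_mu_of_children` and stated over route-independent imports: at the pair take M's
sign `ε`, and apply `SmallImageKatoIntegralOfMu.kobayashiMainConjecture_of_lowerDivisibility_of_mu_eq_zero` (p667339: `p` is prime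
in `Λ`, so Kato's rational inclusion `h41` is integral once `μ^ε = 0`; with the Eisenstein half `hL … ε` this is the equality).
[cite: Kobayashi2003, Thm. 1.2, Thm. 4.1 and Conjecture (p. 2)] [cite: Washington1997, §13.1] [cite: GreenbergVatsal2000, p. 4] -/
theorem kobayashiMainConjectureSmallImage_of_children (hL : SmallImageLowerHalfBothSigns) (hM : SmallImageMuZeroOneSign)
    (hP : SmallImagePrintedInputsMu) : KobayashiMainConjectureSmallImage := by
  intro W _ _ p _ hp hX hCM hap hs
  obtain ⟨ε, hlow, hμ⟩ := lower_and_mu_of_children hL hM W p hp hX hCM hap hs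
  exact ⟨ε, SmallImageKatoIntegralOfMu.kobayashiMainConjecture_of_lowerDivisibility_of_mu_eq_zero W p hP.1 hP.2.1 hP.2.2.1
    hP.2.2.2 hp hX.1.1 hap hlow hμ⟩

/-- **The glue item stmt-BirchSwinnertonDyer-23602, PROVED**: `KobayashiMainConjectureSmallImageOfMuParts` — the route decl
`SmallImageLowerHalfBothSigns → SmallImageMuZeroOneSign → SmallImagePrintedInputsMu → KobayashiMainConjectureSmallImage` — holds
(composition only; the children stay open items).
[cite: Kobayashi2003, Thm. 1.2, Thm. 4.1 and Conjecture (p. 2)] -/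
theorem kobayashiMainConjectureSmallImageOfMuParts_holds : KobayashiMainConjectureSmallImageOfMuParts := by
  unfold KobayashiMainConjectureSmallImageOfMuParts
  intro hL hM hP
  exact kobayashiMainConjectureSmallImage_of_children hL hM hP

/-- **Certificate: the route's in-cone support items supply child P verbatim** — 19286 `KobayashiSignedSelmerTorsion` (Thm. 1.2),
19287 `KobayashiSignedKatoDivisibility` (Thm. 4.1), 19288 `RealPeriodUnitPlusPeriod` (`p ≥ 5`), 19291 `RealPeriodUnitPlusPeriodThree`
(`p = 3`); each is by definition the corresponding Literature named fact.
[cite: Kobayashi2003, Thm. 1.2 and Thm. 4.1] [cite: GreenbergVatsal2000, p. 4] [cite: Mazur1978, Cor. 4.1] -/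
theorem smallImagePrintedInputsMu_of_items (h12 : KobayashiSignedSelmerTorsion) (h41 : KobayashiSignedKatoDivisibility)
    (h5 : RealPeriodUnitPlusPeriod) (h3 : RealPeriodUnitPlusPeriodThree) : SmallImagePrintedInputsMu :=
  ⟨h12, h41, h5, h3⟩

end Summit.BirchSwinnertonDyer.BirchSwinnertonDyer.Theorems.SmallImageMuParts

end
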